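import Summits.QuantumFields.YangMills.Theorems.SwapVirialDeficitBlowUpGnomonicHubShiftSmooth
import Summits.QuantumFields.YangMills.Theorems.SwapVirialDeficitBlowUpGnomonicSeamFloorCoords
import HarnessLib

/-!
# SPEEDS ALONG THE JOINT B-RAY: the moving hub unit `A(s) = ν(axisPoint(a − (sδ)·1))` has `A′(0) = −(δ/‖a‖)·1` (REAL) at an end hub, likewise `Ā(s)`; 4-factor product rule
# (free-hands support of ⟨stmt-QuantumFields-24197⟩ `SwapVirialDeficit.SwapGluedStiffness`; stub (S-B) of LEAD g98's plan of record — calculus set-up for the successor's joint seam floor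
# `…stratumB_seam_joint`, cf. the paper computation on STATUS 19:41Z: the x₀′-square of ✓`fibre_raySecond_ge_stratumB_seam_coords` is unchanged along joint rays)

* `inner_axisPoint_one` (`⟪axisPoint a, 1⟫ = re a`), `hasDerivAt_hubUnit_shift` (`A′(0) = −(δ/‖a‖)·1` for `re a = 0`), `hasDerivAt_star_hubUnit_shift` (same for `Ā`);
* `hasDerivAt_slaved_movingHub` — `(Ā(s)·x̂(s)·A(s)·ẑ(s))′(0) = Ā′x̂₀A₀ + Ā₀X′A₀ + Ā₀x̂₀A′ + Ā₀x̂₀A₀Z′` when `ẑ(0) = 1` (generic 4-factor product rule).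

HONEST LABEL: calculus bookkeeping; stubs of ➎, ⟨24197⟩ ∕ ⟨24194⟩ ∕ ⟨24497⟩ OPEN; own crux ⟨22884⟩ OPEN (blocked-on ⟨19935⟩); the Yang–Mills mass gap is NOT proved; no summit is
proved by a line.  THEOREMS ONLY (0 `def`, 0 `sorry`), standard axioms.  Width seat ym-line-sfw-p2-w3 g66 (cell ym-idea-1, free hands), `--supports stmt-QuantumFields-24197`.
References: [folklore].
-/

set_option autoImplicit false

noncomputable section

open Quaternion
open scoped Quaternion RealInnerProductSpace
open Literature.Analysis.Calculus (radialUnit radialUnit_def norm_radialUnit)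
open Summit.QuantumFields.YangMills.Theorems.SwapTwistDeficit.ToronLog (axisPoint)
open Summit.QuantumFields.YangMills.Theorems.SwapVirialDeficit.ZeroModeGroup (norm_axisPoint)
open Summit.QuantumFields.YangMills.Theorems.SwapVirialDeficit.Gnomonic (axisPoint_sub_smul_one star_radialUnit sub_smul_one_ne_zero)

namespace Summit.QuantumFields.YangMills.Theorems.SwapVirialDeficit.BlowUpRing

/-- `⟪axisPoint a, 1⟫ = re a`. [folklore] -/
theorem inner_axisPoint_one (a : ℍ) : ⟪axisPoint a, (1 : ℍ)⟫ = a.re := by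
  rw [Quaternion.inner_def]; simp [axisPoint]

/-- `⟪star (axisPoint a), 1⟫ = re a`. [folklore] -/
theorem inner_star_axisPoint_one (a : ℍ) : ⟪star (axisPoint a), (1 : ℍ)⟫ = a.re := by
  rw [Quaternion.inner_def]; simp [axisPoint]

/-- ★ **The moving hub unit**: at an END hub (`re a = 0`, `a ≠ 0`), `s ↦ ν(axisPoint (a − (sδ)·1))` has derivative `−(δ/‖a‖)·1` at `0` — a REAL quaternion. [folklore] -/
theorem hasDerivAt_hubUnit_shift {a : ℍ} (ha : a ≠ 0) (hre : a.re = 0) (δ : ℝ) :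
    HasDerivAt (fun s : ℝ => radialUnit (axisPoint (a - (s * δ) • (1 : ℍ)))) (-(δ / ‖a‖) • (1 : ℍ)) 0 := by
  have hX : axisPoint a ≠ 0 := by
    intro h; apply ha; have := norm_axisPoint a; rw [h, norm_zero] at this; exact norm_eq_zero.1 this.symm
  have horth : ⟪axisPoint a, -(δ • (1 : ℍ))⟫ = 0 := by rw [inner_neg_right, inner_smul_right, inner_axisPoint_one, hre, mul_zero, neg_zero]
  have h := hasDerivAt_radialUnit_ray_orth hX horth
  have e : (fun s : ℝ => radialUnit (axisPoint (a - (s * δ) • (1 : ℍ)))) = fun s : ℝ => radialUnit (axisPoint a + s • (-(δ • (1 : ℍ)))) := by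
    funext s; rw [axisPoint_sub_smul_one, mul_smul, smul_neg, sub_eq_add_neg]
  rw [e, show -(δ / ‖a‖) • (1 : ℍ) = ‖axisPoint a‖⁻¹ • (-(δ • (1 : ℍ))) by rw [norm_axisPoint, smul_neg, smul_smul, div_eq_inv_mul, neg_smul]]
  exact h

/-- ★ The conjugate moving hub unit `s ↦ star ν(axisPoint (a − (sδ)·1))` has the same derivative `−(δ/‖a‖)·1` at `0`. [folklore] -/
theorem hasDerivAt_star_hubUnit_shift {a : ℍ} (ha : a ≠ 0) (hre : a.re = 0) (δ : ℝ) :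
    HasDerivAt (fun s : ℝ => star (radialUnit (axisPoint (a - (s * δ) • (1 : ℍ))))) (-(δ / ‖a‖) • (1 : ℍ)) 0 := by
  have hX : star (axisPoint a) ≠ 0 := by
    intro h; apply ha; have := norm_axisPoint a; rw [← norm_star, h, norm_zero] at this; exact norm_eq_zero.1 this.symm
  have horth : ⟪star (axisPoint a), -(δ • (1 : ℍ))⟫ = 0 := by
    rw [inner_neg_right, inner_smul_right, inner_star_axisPoint_one, hre, mul_zero, neg_zero]
  have h := hasDerivAt_radialUnit_ray_orth hX horth
  have e : (fun s : ℝ => star (radialUnit (axisPoint (a - (s * δ) • (1 : ℍ))))) = fun s : ℝ => radialUnit (star (axisPoint a) + s • (-(δ • (1 : ℍ)))) := by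
    funext s
    rw [axisPoint_sub_smul_one, star_radialUnit, star_sub, Quaternion.star_smul, star_one, mul_smul, smul_neg, sub_eq_add_neg]
  rw [e, show -(δ / ‖a‖) • (1 : ℍ) = ‖star (axisPoint a)‖⁻¹ • (-(δ • (1 : ℍ))) by
    rw [norm_star, norm_axisPoint, smul_neg, smul_smul, div_eq_inv_mul, neg_smul]]
  exact h

/-- ★ **Four-factor product rule for the slaved letter with a moving hub**: if `Ā(s), x̂(s), A(s), ẑ(s)` have derivatives `B′, X′, A′, Z′` at `0` and `ẑ(0) = 1`, then
`(Ā·x̂·A·ẑ)′(0) = B′·x̂₀·A₀ + Ā₀·X′·A₀ + Ā₀·x̂₀·A′ + Ā₀·x̂₀·A₀·Z′`. [folklore] -/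
theorem hasDerivAt_slaved_movingHub {Ab xh A zh : ℝ → ℍ} {B' X' A' Z' : ℍ} (hB : HasDerivAt Ab B' 0) (hx : HasDerivAt xh X' 0) (hA : HasDerivAt A A' 0)
    (hz : HasDerivAt zh Z' 0) (hz0 : zh 0 = 1) :
    HasDerivAt (fun s : ℝ => Ab s * xh s * A s * zh s) (B' * xh 0 * A 0 + Ab 0 * X' * A 0 + Ab 0 * xh 0 * A' + Ab 0 * xh 0 * A 0 * Z') 0 := by
  have h := ((hB.fun_mul hx).fun_mul hA).fun_mul hz
  refine h.congr_deriv ?_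
  rw [hz0, mul_one]
  noncomm_ring

end Summit.QuantumFields.YangMills.Theorems.SwapVirialDeficit.BlowUpRing

end
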